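import Literature.Probability.RandomPlanarGeometry.HexSAWStripBGJPrinted
import HarnessLib

/-!
# The width-one strip of the hexagonal lattice, `α`- and `ε`-sides: `A_{1,L}(x) = 2 Σ_{j=1}^{L} x^{2j+1}`, `E_{1,L}(x) = 2x^{2L+2}`, `A₁(x) = 2x³/(1 − x²)`

Topic `Literature/Probability/RandomPlanarGeometry` (continues `HexSAWStripWidthOne.lean` — the classification of the
`β`-walks of the Duminil-Copin–Smirnov strip `S_{1,L}` (`HV.exists_eq_zigWalk`, `HV.stripB_one_eq`,
`HV.stripBlim_one_eq : B₁(x_c) = 2√2 − 2`) — and `HexSAWStripBGJPrinted.lean` — Beaton–Guttmann–Jensen's PRINTED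
width-zero strip generating functions `BGJ12.A0 z = 2z³/(1 − z²)`, `BGJ12.B0 z = 2z²/(1 − z²)` [their width `0` = the
tree's width `1`]).

The tree had the `β`-side of the width-one strip but not the `α`- and `ε`-sides; this file supplies them, by the same argument:
the vertices of `S_{1,L}` form a PATH (position `2x₀ + bit`, `HV.pos1`/`HV.vtx`), a self-avoiding walk from `a` runs
monotonically in one direction `s = ±1`, and it leaves through `α ∖ {a}` exactly at the level-`0` vertices (even
positions `±2j`, `1 ≤ j ≤ L`; position `0` is `a` itself, excluded by "the final half-edge does not retrace"), after
`2j + 1` vertices; and it leaves through the cuts `ε ∪ ε̄` exactly when it runs through the whole strip (`2L + 2` vertices). Hence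

* `HV.exists_eq_zagWalk`, `HV.filter_isAlphaDart_one_eq_image` — the `α`-walks of `S_{1,L}` are exactly the
  `HV.zagWalk s j`, `s = ±1`, `1 ≤ j ≤ L`;
* `HV.stripA_one_eq : stripA 1 L x = 2 Σ_{j=1}^{L} x^{2j+1}` (exactly two width-one `α`-arcs of each odd length
  `3 ≤ 2j+1 ≤ 2L+1`, none of even length);
* `HV.BGJ12.tendsto_stripA_one_A0 : A_{1,L}(x) → A_0(x) = 2x³/(1 − x²)` and `HV.BGJ12.tendsto_stripB_one_B0 :
  B_{1,L}(x) → B_0(x) = 2x²/(1 − x²)` for every `0 ≤ x < 1` — Beaton–Guttmann–Jensen's printed width-zero functions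
  ARE the limits of the tree's width-one strip generating functions [cite: BeatonGuttmannJensen2012, §2 p. 4];
* `HV.epsWalk`, `HV.exists_eq_epsWalk`, `HV.filter_isEpsDart_one_eq_image`, **`HV.stripE_one_eq : stripE 1 L x =
  2 x^{2L+2}`** (the only walks leaving through the cuts `ε ∪ ε̄` are the two full runs), `HV.tendsto_stripE_one :
  E_{1,L}(x) → 0`, and `HV.lemma2_width_one_explicit` — Duminil-Copin–Smirnov's Lemma 2 at `T = 1` read through the
  classification: `1 = cos(3π/8)·2Σ_{j=1}^{L} x_c^{2j+1} + 2Σ_{k=1}^{L+1} x_c^{2k} + cos(π/4)·2x_c^{2L+2}` for every `L`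
  (so all three width-one partition functions are now in closed form);
* `HV.stripAlim_one_eq : A₁(x_c) = stripAlim 1 = x_c (2√2 − 2)` (`= 2x_c³/(1 − x_c²)`), the `α`-companion of
  `HV.stripBlim_one_eq`, and `HV.BGJ12.A0_xc_eq_stripAlim_one` (agreement with the printed value, cf.
  `BGJ12.B0_xc_eq_stripBlim_one`). With `BGJ12.identity_zero` this makes Duminil-Copin–Smirnov's strip identity at
  `T = 1` an explicit closed-form check: `cos(3π/8)·A₁(x_c) + B₁(x_c) = 1` (`HV.BGJ12.identity_stripLim_one`), whence
  `HV.stripElim_one_eq_zero : E₁(x_c) = 0` — the `T = 1` instances of the tree's general, unconditional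
  `HV.stripElim_zero : ∀ T ≥ 1, E_T = 0` and infinite-strip identity (`HexSAWStripIdentity.lean`, Glazman–Manolescu
  Cor. 2.3 [cite: GlazmanManolescu2019, Corollary 2.3]), proved here independently from the closed forms (no
  triangle-domain input); nothing new is claimed for them beyond the explicit values.

No new definitions of notions (three explicit vertex lists `alphaExitV`, `zagWalk`, `epsWalk`, companions of the tree's
`exitV`/`zigWalk`); no named facts.
[cite: DuminilCopinSmirnov2012, §3 (the strip S_{T,L}, A_{T,L}, α)]; [cite: BeatonGuttmannJensen2012, §2 p. 4 (A_0, B_0)].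
Lane «pcv-sawmu», seat lit-2 gen 11 (CLAIM «BGJ12-PRINTED»), 2026-08-22.
-/

noncomputable section

open Finset Filter Topology

namespace Literature.Probability.RandomPlanarGeometry.SAW

namespace HV

/-! ### Exits through `α` -/

/-- `vtx p` is of type `false` iff `p` is even. [cite: DuminilCopinSmirnov2012, §3 (the strip S_{T,L})] -/
theorem vtx_type_eq_false (p : ℤ) : (vtx p).2.2 = false ↔ p % 2 = 0 := by
  have h := vtx_type p
  rcases Int.emod_two_eq_zero_or_one p with hp | hp
  · constructor
    · intro _; exact hp
    · intro _
      cases h' : (vtx p).2.2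
      · rfl
      · exact absurd (h.1 h') (by omega)
  · constructor
    · intro h'
      have := h.2 hp
      rw [h'] at this
      exact absurd this (by decide)
    · intro h'; omega

/-- The level-`0` vertex at an even position, in coordinates. [cite: DuminilCopinSmirnov2012, §3 (the strip S_{T,L})] -/
theorem vtx_two_mul (a : ℤ) : vtx (2 * a) = (a, 0, false) := by
  unfold vtx
  rw [if_pos (by omega)]
  congr 1
  omega

/-- The exit vertex below a level-`0` vertex (the head of its `α` dart). [cite: DuminilCopinSmirnov2012, §3 (α)] -/
def alphaExitV (v : HV) : HV := (v.1, -1, true)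

/-- A level-`0` vertex exits the strip downwards through `α`: `vtx p ~ ((vtx p).1, -1, true)` for even `p`.
[cite: DuminilCopinSmirnov2012, §3 (α)] -/
theorem adj_vtx_alphaExit {p : ℤ} (hp : p % 2 = 0) : hvGraph.Adj (vtx p) (alphaExitV (vtx p)) := by
  rw [hvGraph_adj]
  unfold vtx AdjRel alphaExitV
  simp only [hp, if_true]
  simp

/-! ### The `α`-walks of the width-one strip -/

/-- The mid-edge walk with `2j + 1` inner vertices: `w`, the positions `0, s, …, 2j·s`, then the exit through `α`
below the level-`0` vertex at position `2j·s`. [cite: DuminilCopinSmirnov2012, §3 (S_{T,L}, α)] -/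
def zagWalk (s : ℤ) (j : ℕ) : List HV :=
  wOut :: (zigInner s (2 * j + 1) ++ [alphaExitV (vtx (s * (2 * (j : ℤ))))])

/-- The `α`-walk with `2j + 1` vertices, `1 ≤ j ≤ L`, is a self-avoiding mid-edge walk of `S_{1,L}` ending on
`α ∖ {a}`, of length `ℓ = 2j + 1`. [cite: DuminilCopinSmirnov2012, §3 (S_{T,L}, α)] -/
theorem zagWalk_mem {s : ℤ} (hs : s = 1 ∨ s = -1) {j L : ℕ} (hj : 1 ≤ j) (hjL : j ≤ L) :
    zagWalk s j ∈ (midWalks (stripV 1 L)).filter fun P => IsAlphaDart (finalDart P) := by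
  have hs0 : s ≠ 0 := by rcases hs with rfl | rfl <;> norm_num
  set n := 2 * j + 1 with hn
  set p : ℤ := s * (2 * (j : ℤ)) with hp
  have hpeven : p % 2 = 0 := by rcases hs with rfl | rfl <;> (rw [hp]; omega)
  have hpdiv : p / 2 = s * (j : ℤ) := by rcases hs with rfl | rfl <;> (rw [hp]; omega)
  set e := alphaExitV (vtx p) with he
  -- the last inner vertex
  have hlast : (zigInner s n).getLast? = some (vtx p) := by
    rw [List.getLast?_eq_getElem?, length_zigInner, List.getElem?_eq_getElem (by rw [length_zigInner]; omega),
      getElem_zigInner]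
    congr 2
  have hhead : (zigInner s n ++ [e]).head? = some hvOrigin := by
    rw [hn, zigInner_succ]; rfl
  have hne : zigInner s n ≠ [] := by
    intro h; have := congrArg List.length h; simp [hn] at this
  rw [mem_filter, mem_midWalks_iff]
  refine ⟨⟨?_, rfl, hhead, ?_, ?_, ?_⟩, ?_⟩
  · -- chain
    rw [zagWalk, List.isChain_cons]
    refine ⟨fun y hy => ?_, ?_⟩
    · rw [hhead] at hy
      simp only [Option.mem_def, Option.some.injEq] at hy
      subst hy
      exact adj_wOut_hvOrigin
    · rw [List.isChain_append]
      refine ⟨isChain_zigInner hs n, List.isChain_singleton _, fun x hx y hy => ?_⟩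
      rw [hlast] at hx
      simp only [Option.mem_def, Option.some.injEq, List.head?_cons] at hx hy
      subst hx; subst hy
      exact adj_vtx_alphaExit hpeven
  · -- inner vertices in the strip
    intro x hx
    rw [zagWalk, inner_cons, List.dropLast_concat] at hx
    exact zigInner_subset_stripV hs (by omega) x hx
  · -- nodup
    rw [zagWalk, inner_cons, List.dropLast_concat]
    exact nodup_zigInner hs0 n
  · -- the final half-edge does not retrace (`e ≠ w` since `j ≥ 1`, and `e` is not on the path)
    rw [zagWalk]
    intro h
    have h1 : (wOut :: (zigInner s n ++ [e])).getLast? = some e := by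
      rw [← List.cons_append, List.getLast?_concat]
    rw [h1, List.dropLast_cons_of_ne_nil (by simp), List.dropLast_concat] at h
    have hmem : e ∈ (wOut :: zigInner s n).dropLast := List.mem_of_mem_getLast? h
    have hmem' : e ∈ wOut :: zigInner s n := List.mem_of_mem_dropLast hmem
    rcases List.mem_cons.1 hmem' with h2 | h2
    · have he1 : e.1 = s * (j : ℤ) := by rw [he, alphaExitV, vtx_fst, hpdiv]
      rw [h2] at he1
      have : (s * (j : ℤ)) = 0 := by rw [← he1]; rfl
      rcases mul_eq_zero.1 this with h3 | h3
      · exact hs0 h3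
      · omega
    · obtain ⟨i, -, hi⟩ := mem_zigInner.1 h2
      have he2 : e.2.1 = -1 := by rw [he]; rfl
      rw [hi, vtx_snd] at he2
      exact absurd he2 (by norm_num)
  · -- the final dart is on `α`
    have hfd : finalDart (zagWalk s j) = (vtx p, e) := by
      rw [finalDart, zagWalk]
      have h1 : (wOut :: (zigInner s n ++ [e])).getLast? = some e := by
        rw [← List.cons_append, List.getLast?_concat]
      obtain ⟨ys, hys⟩ := List.getLast?_eq_some_iff.1 hlast
      have h2 : (wOut :: zigInner s n).getLast? = some (vtx p) := by
        rw [hys, ← List.cons_append, List.getLast?_concat]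
      rw [h1, List.dropLast_cons_of_ne_nil (by simp), List.dropLast_concat, h2]
      rfl
    rw [hfd]
    exact ⟨vtx_snd p, (vtx_type_eq_false p).2 hpeven, rfl⟩

/-- The `α`-walk with `2j + 1` vertices has `ℓ = 2j + 1`. [cite: DuminilCopinSmirnov2012, §3 (the strip S_{T,L})] -/
theorem mwLen_zagWalk (s : ℤ) (j : ℕ) : mwLen (zagWalk s j) = 2 * j + 1 := by
  simp [mwLen, zagWalk]

/-! ### Classification of the `α`-walks of the width-one strip -/

/-- **Every self-avoiding mid-edge walk of `S_{1,L}` ending on `α ∖ {a}` is a `zagWalk`**: its inner vertices run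
monotonically along the path, the last one is of type `0` (even position `2j·s`), and `j ≥ 1` because the walk of
one vertex leaving through the edge below `O` would retrace `a`. [cite: DuminilCopinSmirnov2012, §3 (S_{T,L}, α)] -/
theorem exists_eq_zagWalk {L : ℕ} {P : List HV}
    (hP : P ∈ (midWalks (stripV 1 L)).filter fun P => IsAlphaDart (finalDart P)) :
    ∃ s : ℤ, (s = 1 ∨ s = -1) ∧ ∃ j : ℕ, 1 ≤ j ∧ j ≤ L ∧ P = zagWalk s j := by
  rw [mem_filter, mem_midWalks_iff] at hP
  obtain ⟨hmw, hα⟩ := hP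
  obtain ⟨Q, rfl⟩ := hmw.exists_eq_cons
  obtain ⟨hchain, -, -, hV, hnodup, hretr⟩ := hmw
  -- the trivial walk `[w, O]` does not end on `α ∖ {a}` (its final dart is `(w, O)`)
  rcases eq_or_ne Q [] with rfl | hQ
  · simp [finalDart, IsAlphaDart, wOut] at hα
  -- `R = O :: Q = I ++ [u]`, `I = inner P`
  have hRne : (hvOrigin :: Q) ≠ [] := List.cons_ne_nil _ _
  set I : List HV := (hvOrigin :: Q).dropLast with hI
  set u : HV := (hvOrigin :: Q).getLast hRne with hu
  have hRsplit : hvOrigin :: Q = I ++ [u] := (List.dropLast_append_getLast hRne).symm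
  have hIeq : I = hvOrigin :: Q.dropLast := by rw [hI, List.dropLast_cons_of_ne_nil hQ]
  have hIne : I ≠ [] := by rw [hIeq]; exact List.cons_ne_nil _ _
  set m := I.length with hm
  have hm1 : 1 ≤ m := by rw [hm, hIeq]; simp
  have hI0 : I[0]'(by omega) = hvOrigin := by simp [hIeq]
  -- inner vertices, chain, nodup
  have hinner : inner (wOut :: hvOrigin :: Q) = I := rfl
  rw [hinner] at hV hnodup
  have hx1 : ∀ i (hi : i < m), (I[i]).2.1 = 0 := fun i hi =>
    (mem_stripV_one_iff.1 (hV _ (List.getElem_mem hi))).1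
  have hchainR : (I ++ [u]).IsChain hvGraph.Adj := by
    rw [← hRsplit]; exact (List.isChain_cons.1 hchain).2
  have hchainI : ∀ i (hi : i + 1 < m), hvGraph.Adj (I[i]) (I[i + 1]) := by
    have := (List.isChain_append.1 hchainR).1
    rw [List.isChain_iff_getElem] at this
    exact this
  -- the final dart `(I.getLast, u)`
  have hlastI : I.getLast hIne = I[m - 1]'(by omega) := List.getLast_eq_getElem hIne
  have hfd : finalDart (wOut :: hvOrigin :: Q) = (I[m - 1]'(by omega), u) := by
    rw [finalDart, hRsplit]
    have h1 : (wOut :: (I ++ [u])).getLast? = some u := by rw [← List.cons_append, List.getLast?_concat]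
    obtain ⟨ys, hys⟩ := List.getLast?_eq_some_iff.1 (List.getLast?_eq_some_getLast hIne)
    have h2 : (wOut :: I).getLast? = some (I.getLast hIne) := by
      have e : wOut :: I = (wOut :: ys) ++ [I.getLast hIne] := by
        rw [List.cons_append]; exact congrArg (wOut :: ·) hys
      rw [e, List.getLast?_concat]
    rw [h1, List.dropLast_cons_of_ne_nil (by simp), List.dropLast_concat, h2, hlastI]
    rfl
  rw [hfd] at hα
  obtain ⟨-, htype, hu_eq⟩ := hα
  simp only at htype hu_eq
  -- the positions: `pos1 I[i] = s i`
  set f : ℕ → ℤ := fun i => if h : i < m then pos1 (I[i]) else 0 with hf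
  have hfval : ∀ i (hi : i < m), f i = pos1 (I[i]) := fun i hi => by simp [hf, hi]
  have hf0 : f 0 = 0 := by rw [hfval 0 (by omega), hI0]; rfl
  have hfstep : ∀ i, i + 1 ≤ m - 1 → f (i + 1) = f i + 1 ∨ f (i + 1) = f i - 1 := by
    intro i hi
    rw [hfval i (by omega), hfval (i + 1) (by omega)]
    exact pos1_step (hx1 i (by omega)) (hx1 (i + 1) (by omega)) (hchainI i (by omega))
  have hfinj : ∀ i j, i ≤ m - 1 → j ≤ m - 1 → f i = f j → i = j := by
    intro i j hi hj hij
    rw [hfval i (by omega), hfval j (by omega)] at hij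
    have := eq_of_pos1_eq (hx1 i (by omega)) (hx1 j (by omega)) hij
    exact (List.Nodup.getElem_inj_iff hnodup).1 this
  have hlin := eq_mul_of_unit_steps hf0 hfstep hfinj
  -- `m ≥ 2`: for `m = 1` the walk is `[w, O, w]`, retracing `a`
  have hm2 : 2 ≤ m := by
    by_contra hlt
    have hm1' : m = 1 := by omega
    have hIO : I = [hvOrigin] := by
      refine List.ext_getElem (by simp [← hm, hm1']) fun i h1 h2 => ?_
      have hi0 : i = 0 := by simp at h2; omega
      subst hi0
      simpa using hI0
    have hlastO : I[m - 1]'(by omega) = hvOrigin := by simp only [hm1', Nat.sub_self]; exact hI0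
    rw [hlastO] at hu_eq
    have huw : u = wOut := by rw [hu_eq]; rfl
    apply hretr
    rw [hRsplit, hIO, huw]
    rfl
  set σ : ℤ := f 1 with hσ
  have hσ1 : σ = 1 ∨ σ = -1 := by
    have := hfstep 0 (by omega)
    rw [zero_add, hf0] at this
    simpa using this
  have hIi : ∀ i (hi : i < m), I[i] = vtx (σ * i) := fun i hi => by
    rw [← vtx_pos1 (hx1 i hi), ← hfval i hi, hlin i (by omega)]
  have hIzig : I = zigInner σ m := by
    refine List.ext_getElem (by simp [hm]) fun i h1 h2 => ?_
    rw [hIi i h1, getElem_zigInner]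
  -- `m = 2j + 1`
  have hlast_vtx : I[m - 1]'(by omega) = vtx (σ * ((m : ℤ) - 1)) := by
    rw [hIi (m - 1) (by omega)]; push_cast [Nat.cast_sub hm1]; ring_nf
  have heven : (σ * ((m : ℤ) - 1)) % 2 = 0 := by
    rw [hlast_vtx, vtx_type_eq_false] at htype; exact htype
  obtain ⟨j, hj⟩ : ∃ j, m = 2 * j + 1 := ⟨m / 2, by rcases hσ1 with h | h <;> (rw [h] at heven; omega)⟩
  have hj1 : 1 ≤ j := by omega
  -- `j ≤ L` from the last vertex being in the strip
  have hjL : j ≤ L := by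
    have hmem := mem_stripV_one_iff.1 (hV _ (List.getElem_mem (by omega : m - 1 < m)))
    rw [hlast_vtx, bit_vtx, vtx_fst] at hmem
    obtain ⟨-, hlo, hhi⟩ := hmem
    rw [hj] at hlo hhi
    push_cast at hlo hhi
    rcases hσ1 with h | h <;> (rw [h] at hlo hhi; omega)
  refine ⟨σ, hσ1, j, hj1, hjL, ?_⟩
  -- assemble
  rw [zagWalk, hRsplit, hIzig, hu_eq, hlast_vtx, hj]
  have e1 : σ * (((2 * j + 1 : ℕ) : ℤ) - 1) = σ * (2 * (j : ℤ)) := by push_cast; ring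
  rw [e1]
  rfl

/-! ### `A_{1,L}(x) = 2 Σ_{j=1}^{L} x^{2j+1}` -/

/-- The length of an `α`-walk list. [cite: DuminilCopinSmirnov2012, §3 (the strip S_{T,L})] -/
theorem length_zagWalk (s : ℤ) (j : ℕ) : (zagWalk s j).length = 2 * j + 3 := by
  simp [zagWalk]

/-- The second inner vertex of an `α`-walk reads off its direction. [cite: DuminilCopinSmirnov2012, §3 (the strip S_{T,L})] -/
theorem zagWalk_getElem_two {s : ℤ} {j : ℕ} (hj : 1 ≤ j) (h : 2 < (zagWalk s j).length) :
    (zagWalk s j)[2] = vtx s := by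
  have h1 : 1 < (zigInner s (2 * j + 1)).length := by rw [length_zigInner]; omega
  simp only [zagWalk, List.getElem_cons_succ]
  rw [List.getElem_append_left h1, getElem_zigInner]
  simp

/-- The `α`-walks with different data are different lists. [cite: DuminilCopinSmirnov2012, §3 (the strip S_{T,L})] -/
theorem zagWalk_injOn (L : ℕ) :
    Set.InjOn (fun q : ℤ × ℕ => zagWalk q.1 q.2) ↑((({1, -1} : Finset ℤ)) ×ˢ Icc 1 L) := by
  rintro ⟨s, k⟩ hq ⟨s', k'⟩ hq' h
  simp only [coe_product, Set.mem_prod, mem_coe, mem_Icc] at hq hq'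
  simp only at h
  have hk : k = k' := by
    have := congrArg List.length h
    rw [length_zagWalk, length_zagWalk] at this
    omega
  subst hk
  have h2 : (zagWalk s k)[2]'(by rw [length_zagWalk]; omega) = (zagWalk s' k)[2]'(by rw [length_zagWalk]; omega) := by
    simp only [h]
  rw [zagWalk_getElem_two hq.2.1, zagWalk_getElem_two hq'.2.1] at h2
  have := congrArg pos1 h2
  rw [pos1_vtx, pos1_vtx] at this
  rw [this]

/-- **The `α`-walks of `S_{1,L}` are exactly the walks** `zagWalk s j`, `s = ±1`, `1 ≤ j ≤ L`.
[cite: DuminilCopinSmirnov2012, §3 (S_{T,L}, α)] -/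
theorem filter_isAlphaDart_one_eq_image (L : ℕ) :
    (midWalks (stripV 1 L)).filter (fun P => IsAlphaDart (finalDart P)) =
      ((({1, -1} : Finset ℤ)) ×ˢ Icc 1 L).image fun q => zagWalk q.1 q.2 := by
  ext P
  constructor
  · intro hP
    obtain ⟨s, hs, j, hj1, hjL, rfl⟩ := exists_eq_zagWalk hP
    refine mem_image.2 ⟨(s, j), mem_product.2 ⟨?_, mem_Icc.2 ⟨hj1, hjL⟩⟩, rfl⟩
    rcases hs with rfl | rfl <;> simp
  · intro hP
    obtain ⟨⟨s, j⟩, hq, rfl⟩ := mem_image.1 hP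
    rw [mem_product, mem_Icc] at hq
    obtain ⟨hs, hj1, hjL⟩ := hq
    have hs' : s = 1 ∨ s = -1 := by simpa using hs
    exact zagWalk_mem hs' hj1 hjL

/-- **`A_{1,L}(x) = 2 Σ_{j=1}^{L} x^{2j+1}`**: exactly two width-one `α`-arcs of each odd length `2j + 1`,
`1 ≤ j ≤ L`, none of even length. [cite: DuminilCopinSmirnov2012, §3 (A_{T,L})] -/
theorem stripA_one_eq (L : ℕ) (x : ℝ) : stripA 1 L x = 2 * ∑ j ∈ Icc 1 L, x ^ (2 * j + 1) := by
  rw [stripA, filter_isAlphaDart_one_eq_image, sum_image (zagWalk_injOn L), sum_product]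
  simp only [mwLen_zagWalk]
  rw [sum_pair (by norm_num : (1 : ℤ) ≠ -1)]
  ring

/-! ### The limits `L → ∞`: Beaton–Guttmann–Jensen's printed width-zero functions -/

/-- `Σ_{k=1}^{n} q^k + 1 = Σ_{k<n+1} q^k`. [folklore] -/
private theorem sum_Icc_pow_add_one' (q : ℝ) (n : ℕ) :
    ∑ k ∈ Icc 1 n, q ^ k + 1 = ∑ k ∈ range (n + 1), q ^ k := by
  induction n with
  | zero => simp
  | succ n ih => rw [sum_Icc_succ_top (by omega), sum_range_succ, ← ih]; ring

/-- `Σ_{k=1}^{n} q^k → q/(1 − q)` for `0 ≤ q < 1`. [folklore] -/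
private theorem tendsto_sum_Icc_pow {q : ℝ} (hq0 : 0 ≤ q) (hq1 : q < 1) :
    Tendsto (fun n : ℕ => ∑ k ∈ Icc 1 n, q ^ k) atTop (𝓝 (q / (1 - q))) := by
  have h1q : (1 : ℝ) - q ≠ 0 := by linarith
  have hgeo := (hasSum_geometric_of_lt_one hq0 hq1).tendsto_sum_nat
  have h2 := (hgeo.comp (tendsto_add_atTop_nat 1)).sub_const 1
  have hlim : (1 - q)⁻¹ - 1 = q / (1 - q) := by field_simp; ring
  rw [← hlim]
  refine h2.congr fun n => ?_
  simp only [Function.comp_apply]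
  rw [← sum_Icc_pow_add_one']
  ring

namespace BGJ12

/-- **`A_{1,L}(x) → A_0(x) = 2x³/(1 − x²)` (Beaton–Guttmann–Jensen's printed `A_0`) as `L → ∞`**, for every
`0 ≤ x < 1`. [cite: BeatonGuttmannJensen2012, §2 p. 4 (A_0(z)); DuminilCopinSmirnov2012, §3 (A_{T,L})] -/
theorem tendsto_stripA_one_A0 {x : ℝ} (hx0 : 0 ≤ x) (hx1 : x < 1) :
    Tendsto (fun L : ℕ => stripA 1 L x) atTop (𝓝 (A0 x)) := by
  set q : ℝ := x ^ 2 with hq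
  have hq0 : 0 ≤ q := by positivity
  have hq1 : q < 1 := by rw [hq]; nlinarith
  have h1q : (1 : ℝ) - q ≠ 0 := by linarith
  have hg : ∀ L : ℕ, stripA 1 L x = 2 * (x * ∑ j ∈ Icc 1 L, q ^ j) := by
    intro L
    rw [stripA_one_eq]
    congr 1
    rw [Finset.mul_sum]
    refine sum_congr rfl fun j _ => ?_
    rw [hq, ← pow_mul, pow_succ]
    ring
  have hlim : 2 * (x * (q / (1 - q))) = A0 x := by
    rw [A0, hq]
    have : (1 : ℝ) - x ^ 2 ≠ 0 := by rw [← hq]; exact h1q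
    field_simp
  rw [← hlim]
  refine (((tendsto_sum_Icc_pow hq0 hq1).const_mul x).const_mul 2).congr fun L => (hg L).symm

/-- **`B_{1,L}(x) → B_0(x) = 2x²/(1 − x²)` (Beaton–Guttmann–Jensen's printed `B_0`) as `L → ∞`**, for every
`0 ≤ x < 1`, from the tree's `HV.stripB_one_eq`. [cite: BeatonGuttmannJensen2012, §2 p. 4 (B_0(z));
DuminilCopinSmirnov2012, §3 (B_{T,L})] -/
theorem tendsto_stripB_one_B0 {x : ℝ} (hx0 : 0 ≤ x) (hx1 : x < 1) :
    Tendsto (fun L : ℕ => stripB 1 L x) atTop (𝓝 (B0 x)) := by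
  set q : ℝ := x ^ 2 with hq
  have hq0 : 0 ≤ q := by positivity
  have hq1 : q < 1 := by rw [hq]; nlinarith
  have h1q : (1 : ℝ) - q ≠ 0 := by linarith
  have hg : ∀ L : ℕ, stripB 1 L x = 2 * ∑ k ∈ Icc 1 (L + 1), q ^ k := by
    intro L
    rw [stripB_one_eq]
    congr 1
    refine sum_congr rfl fun k _ => ?_
    rw [hq, ← pow_mul]
  have hlim : 2 * (q / (1 - q)) = B0 x := by
    rw [B0, hq, mul_div_assoc]
  rw [← hlim]
  have h2 := ((tendsto_sum_Icc_pow hq0 hq1).comp (tendsto_add_atTop_nat 1)).const_mul 2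
  refine h2.congr fun L => ?_
  simp only [Function.comp_apply]
  exact (hg L).symm

end BGJ12

/-! ### The `ε`-walks of the width-one strip: `E_{1,L}(x) = 2 x^{2L+2}` -/

/-- The mid-edge walk running through the whole strip in direction `s`: `w`, the positions `0, s, …, (2L+1)s`, then the
exit across the oblique cut to position `(2L+2)s`. [cite: DuminilCopinSmirnov2012, §3 (S_{T,L}, ε, ε̄)] -/
def epsWalk (s : ℤ) (L : ℕ) : List HV :=
  wOut :: (zigInner s (2 * L + 2) ++ [vtx (s * (2 * (L : ℤ) + 2))])

/-- The two full runs are self-avoiding mid-edge walks of `S_{1,L}` ending on `ε ∪ ε̄`, of length `ℓ = 2L + 2`.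
[cite: DuminilCopinSmirnov2012, §3 (S_{T,L}, ε, ε̄)] -/
theorem epsWalk_mem {s : ℤ} (hs : s = 1 ∨ s = -1) (L : ℕ) :
    epsWalk s L ∈ (midWalks (stripV 1 L)).filter fun P => IsEpsDart L (finalDart P) := by
  have hs0 : s ≠ 0 := by rcases hs with rfl | rfl <;> norm_num
  set n := 2 * L + 2 with hn
  set p : ℤ := s * (2 * (L : ℤ) + 1) with hp
  have hpodd : p % 2 = 1 := by rcases hs with rfl | rfl <;> (rw [hp]; omega)
  set e := vtx (s * (2 * (L : ℤ) + 2)) with he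
  have hpe : s * (2 * (L : ℤ) + 2) = p + s := by rw [hp]; ring
  -- the last inner vertex
  have hlast : (zigInner s n).getLast? = some (vtx p) := by
    rw [List.getLast?_eq_getElem?, length_zigInner, List.getElem?_eq_getElem (by rw [length_zigInner]; omega),
      getElem_zigInner]
    congr 2
  have hhead : (zigInner s n ++ [e]).head? = some hvOrigin := by
    rw [hn, zigInner_succ]; rfl
  rw [mem_filter, mem_midWalks_iff]
  refine ⟨⟨?_, rfl, hhead, ?_, ?_, ?_⟩, ?_⟩
  · -- chain
    rw [epsWalk, List.isChain_cons]
    refine ⟨fun y hy => ?_, ?_⟩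
    · rw [hhead] at hy
      simp only [Option.mem_def, Option.some.injEq] at hy
      subst hy
      exact adj_wOut_hvOrigin
    · rw [List.isChain_append]
      refine ⟨isChain_zigInner hs n, List.isChain_singleton _, fun x hx y hy => ?_⟩
      rw [hlast] at hx
      simp only [Option.mem_def, Option.some.injEq, List.head?_cons] at hx hy
      subst hx; subst hy
      rw [hpe]
      rcases hs with rfl | rfl
      · exact adj_vtx_succ p
      · rw [← sub_eq_add_neg]; exact adj_vtx_pred p
  · -- inner vertices in the strip
    intro x hx
    rw [epsWalk, inner_cons, List.dropLast_concat] at hx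
    exact zigInner_subset_stripV hs (by omega) x hx
  · -- nodup
    rw [epsWalk, inner_cons, List.dropLast_concat]
    exact nodup_zigInner hs0 n
  · -- the final half-edge does not retrace: `e` is beyond the end of the path and is not `w`
    rw [epsWalk]
    intro h
    have h1 : (wOut :: (zigInner s n ++ [e])).getLast? = some e := by
      rw [← List.cons_append, List.getLast?_concat]
    rw [h1, List.dropLast_cons_of_ne_nil (by simp), List.dropLast_concat] at h
    have hmem : e ∈ (wOut :: zigInner s n).dropLast := List.mem_of_mem_getLast? h
    have hmem' : e ∈ wOut :: zigInner s n := List.mem_of_mem_dropLast hmem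
    rcases List.mem_cons.1 hmem' with h2 | h2
    · have he2 : e.2.1 = 0 := by rw [he]; exact vtx_snd _
      rw [h2] at he2
      exact absurd he2 (by decide)
    · obtain ⟨i, hi, hie⟩ := mem_zigInner.1 h2
      have := congrArg pos1 hie
      rw [he, pos1_vtx, pos1_vtx] at this
      have hi' : (i : ℤ) ≤ 2 * L + 1 := by exact_mod_cast (by omega : i ≤ 2 * L + 1)
      rcases hs with rfl | rfl <;> (simp only [one_mul, neg_mul] at this; omega)
  · -- the final dart is on `ε ∪ ε̄`
    have hfd : finalDart (epsWalk s L) = (vtx p, e) := by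
      rw [finalDart, epsWalk]
      have h1 : (wOut :: (zigInner s n ++ [e])).getLast? = some e := by
        rw [← List.cons_append, List.getLast?_concat]
      obtain ⟨ys, hys⟩ := List.getLast?_eq_some_iff.1 hlast
      have h2 : (wOut :: zigInner s n).getLast? = some (vtx p) := by
        rw [hys, ← List.cons_append, List.getLast?_concat]
      rw [h1, List.dropLast_cons_of_ne_nil (by simp), List.dropLast_concat, h2]
      rfl
    rw [hfd]
    refine ⟨(vtx_type p).2 hpodd, ?_⟩
    simp only [vtx_snd, vtx_fst]
    rcases hs with rfl | rfl
    · right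
      refine ⟨by rw [hp]; omega, ?_⟩
      rw [he, show (1 : ℤ) * (2 * (L : ℤ) + 2) = 2 * ((L : ℤ) + 1) by ring, vtx_two_mul, hp]
      congr 1
      omega
    · left
      refine ⟨by rw [hp]; omega, ?_⟩
      rw [he, show (-1 : ℤ) * (2 * (L : ℤ) + 2) = 2 * (-(L : ℤ) - 1) by ring, vtx_two_mul, hp]
      congr 1
      omega

/-- The full run has `ℓ = 2L + 2`. [cite: DuminilCopinSmirnov2012, §3 (the strip S_{T,L})] -/
theorem mwLen_epsWalk (s : ℤ) (L : ℕ) : mwLen (epsWalk s L) = 2 * L + 2 := by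
  simp [mwLen, epsWalk]

/-- **Every self-avoiding mid-edge walk of `S_{1,L}` ending on `ε ∪ ε̄` is one of the two full runs.**
[cite: DuminilCopinSmirnov2012, §3 (S_{T,L}, ε, ε̄)] -/
theorem exists_eq_epsWalk {L : ℕ} {P : List HV}
    (hP : P ∈ (midWalks (stripV 1 L)).filter fun P => IsEpsDart L (finalDart P)) :
    ∃ s : ℤ, (s = 1 ∨ s = -1) ∧ P = epsWalk s L := by
  rw [mem_filter, mem_midWalks_iff] at hP
  obtain ⟨hmw, hε⟩ := hP
  obtain ⟨Q, rfl⟩ := hmw.exists_eq_cons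
  obtain ⟨hchain, -, -, hV, hnodup, -⟩ := hmw
  -- the trivial walk `[w, O]` does not end on `ε ∪ ε̄`
  rcases eq_or_ne Q [] with rfl | hQ
  · simp [finalDart, IsEpsDart, wOut, hvOrigin] at hε
  -- `R = O :: Q = I ++ [u]`, `I = inner P`
  have hRne : (hvOrigin :: Q) ≠ [] := List.cons_ne_nil _ _
  set I : List HV := (hvOrigin :: Q).dropLast with hI
  set u : HV := (hvOrigin :: Q).getLast hRne with hu
  have hRsplit : hvOrigin :: Q = I ++ [u] := (List.dropLast_append_getLast hRne).symm
  have hIeq : I = hvOrigin :: Q.dropLast := by rw [hI, List.dropLast_cons_of_ne_nil hQ]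
  have hIne : I ≠ [] := by rw [hIeq]; exact List.cons_ne_nil _ _
  set m := I.length with hm
  have hm1 : 1 ≤ m := by rw [hm, hIeq]; simp
  have hI0 : I[0]'(by omega) = hvOrigin := by simp [hIeq]
  -- inner vertices, chain, nodup
  have hinner : inner (wOut :: hvOrigin :: Q) = I := rfl
  rw [hinner] at hV hnodup
  have hx1 : ∀ i (hi : i < m), (I[i]).2.1 = 0 := fun i hi =>
    (mem_stripV_one_iff.1 (hV _ (List.getElem_mem hi))).1
  have hchainR : (I ++ [u]).IsChain hvGraph.Adj := by
    rw [← hRsplit]; exact (List.isChain_cons.1 hchain).2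
  have hchainI : ∀ i (hi : i + 1 < m), hvGraph.Adj (I[i]) (I[i + 1]) := by
    have := (List.isChain_append.1 hchainR).1
    rw [List.isChain_iff_getElem] at this
    exact this
  -- the final dart `(I.getLast, u)`
  have hlastI : I.getLast hIne = I[m - 1]'(by omega) := List.getLast_eq_getElem hIne
  have hfd : finalDart (wOut :: hvOrigin :: Q) = (I[m - 1]'(by omega), u) := by
    rw [finalDart, hRsplit]
    have h1 : (wOut :: (I ++ [u])).getLast? = some u := by rw [← List.cons_append, List.getLast?_concat]
    obtain ⟨ys, hys⟩ := List.getLast?_eq_some_iff.1 (List.getLast?_eq_some_getLast hIne)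
    have h2 : (wOut :: I).getLast? = some (I.getLast hIne) := by
      have e : wOut :: I = (wOut :: ys) ++ [I.getLast hIne] := by
        rw [List.cons_append]; exact congrArg (wOut :: ·) hys
      rw [e, List.getLast?_concat]
    rw [h1, List.dropLast_cons_of_ne_nil (by simp), List.dropLast_concat, h2, hlastI]
    rfl
  rw [hfd] at hε
  obtain ⟨htype, hdisj⟩ := hε
  simp only at htype hdisj
  -- the positions: `pos1 I[i] = s i`
  set f : ℕ → ℤ := fun i => if h : i < m then pos1 (I[i]) else 0 with hf
  have hfval : ∀ i (hi : i < m), f i = pos1 (I[i]) := fun i hi => by simp [hf, hi]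
  have hf0 : f 0 = 0 := by rw [hfval 0 (by omega), hI0]; rfl
  have hfstep : ∀ i, i + 1 ≤ m - 1 → f (i + 1) = f i + 1 ∨ f (i + 1) = f i - 1 := by
    intro i hi
    rw [hfval i (by omega), hfval (i + 1) (by omega)]
    exact pos1_step (hx1 i (by omega)) (hx1 (i + 1) (by omega)) (hchainI i (by omega))
  have hfinj : ∀ i j, i ≤ m - 1 → j ≤ m - 1 → f i = f j → i = j := by
    intro i j hi hj hij
    rw [hfval i (by omega), hfval j (by omega)] at hij
    have := eq_of_pos1_eq (hx1 i (by omega)) (hx1 j (by omega)) hij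
    exact (List.Nodup.getElem_inj_iff hnodup).1 this
  have hlin := eq_mul_of_unit_steps hf0 hfstep hfinj
  -- `m ≥ 2`: the last inner vertex has type `1`, `O` has type `0`
  have hm2 : 2 ≤ m := by
    by_contra hlt
    have hm1' : m = 1 := by omega
    have : I[m - 1]'(by omega) = hvOrigin := by simp only [hm1', Nat.sub_self]; exact hI0
    rw [this] at htype
    exact absurd htype (by decide)
  set σ : ℤ := f 1 with hσ
  have hσ1 : σ = 1 ∨ σ = -1 := by
    have := hfstep 0 (by omega)
    rw [zero_add, hf0] at this
    simpa using this
  have hIi : ∀ i (hi : i < m), I[i] = vtx (σ * i) := fun i hi => by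
    rw [← vtx_pos1 (hx1 i hi), ← hfval i hi, hlin i (by omega)]
  have hIzig : I = zigInner σ m := by
    refine List.ext_getElem (by simp [hm]) fun i h1 h2 => ?_
    rw [hIi i h1, getElem_zigInner]
  have hlast_vtx : I[m - 1]'(by omega) = vtx (σ * ((m : ℤ) - 1)) := by
    rw [hIi (m - 1) (by omega)]; push_cast [Nat.cast_sub hm1]; ring_nf
  have hodd : (σ * ((m : ℤ) - 1)) % 2 = 1 := by
    rw [hlast_vtx, vtx_type] at htype; exact htype
  rw [hlast_vtx, vtx_fst, vtx_snd] at hdisj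
  -- `m = 2L + 2` and the exit vertex, from the cut that is crossed
  have hm_eq : m = 2 * L + 2 ∧ u = vtx (σ * (2 * (L : ℤ) + 2)) := by
    have hm1z : (1 : ℤ) ≤ (m : ℤ) - 1 := by
      have : (2 : ℤ) ≤ m := by exact_mod_cast hm2
      linarith
    rcases hσ1 with h | h
    · rw [h] at hdisj hodd ⊢
      rcases hdisj with ⟨hcut, hu'⟩ | ⟨hcut, hu'⟩
      · exfalso; omega
      · refine ⟨by omega, ?_⟩
        rw [hu', show (1 : ℤ) * (2 * (L : ℤ) + 2) = 2 * ((L : ℤ) + 1) by ring, vtx_two_mul]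
        congr 1
        omega
    · rw [h] at hdisj hodd ⊢
      rcases hdisj with ⟨hcut, hu'⟩ | ⟨hcut, hu'⟩
      · refine ⟨by omega, ?_⟩
        rw [hu', show (-1 : ℤ) * (2 * (L : ℤ) + 2) = 2 * (-(L : ℤ) - 1) by ring, vtx_two_mul]
        congr 1
        omega
      · exfalso; omega
  obtain ⟨hmL, hu_eq⟩ := hm_eq
  refine ⟨σ, hσ1, ?_⟩
  rw [epsWalk, hRsplit, hIzig, hu_eq, hmL]

/-- The length of a full-run list. [cite: DuminilCopinSmirnov2012, §3 (the strip S_{T,L})] -/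
theorem length_epsWalk (s : ℤ) (L : ℕ) : (epsWalk s L).length = 2 * L + 4 := by
  simp [epsWalk]

/-- The second inner vertex of a full run reads off its direction. [cite: DuminilCopinSmirnov2012, §3 (the strip S_{T,L})] -/
theorem epsWalk_getElem_two (s : ℤ) (L : ℕ) (h : 2 < (epsWalk s L).length) : (epsWalk s L)[2] = vtx s := by
  have h1 : 1 < (zigInner s (2 * L + 2)).length := by rw [length_zigInner]; omega
  simp only [epsWalk, List.getElem_cons_succ]
  rw [List.getElem_append_left h1, getElem_zigInner]
  simp

/-- **The `ε ∪ ε̄`-walks of `S_{1,L}` are exactly the two full runs** `epsWalk (±1) L`.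
[cite: DuminilCopinSmirnov2012, §3 (S_{T,L}, ε, ε̄)] -/
theorem filter_isEpsDart_one_eq_image (L : ℕ) :
    (midWalks (stripV 1 L)).filter (fun P => IsEpsDart L (finalDart P)) =
      ({1, -1} : Finset ℤ).image fun s => epsWalk s L := by
  ext P
  constructor
  · intro hP
    obtain ⟨s, hs, rfl⟩ := exists_eq_epsWalk hP
    refine mem_image.2 ⟨s, ?_, rfl⟩
    rcases hs with rfl | rfl <;> simp
  · intro hP
    obtain ⟨s, hs, rfl⟩ := mem_image.1 hP
    have hs' : s = 1 ∨ s = -1 := by simpa using hs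
    exact epsWalk_mem hs' L

/-- **`E_{1,L}(x) = 2 x^{2L+2}`**: the only width-one walks leaving through the cuts are the two full runs.
[cite: DuminilCopinSmirnov2012, §3 (E_{T,L})] -/
theorem stripE_one_eq (L : ℕ) (x : ℝ) : stripE 1 L x = 2 * x ^ (2 * L + 2) := by
  rw [stripE, filter_isEpsDart_one_eq_image, sum_image, sum_pair (by norm_num : (1 : ℤ) ≠ -1), mwLen_epsWalk,
    mwLen_epsWalk]
  · ring
  · intro s hs s' hs' h
    have h2 : (epsWalk s L)[2]'(by rw [length_epsWalk]; omega) = (epsWalk s' L)[2]'(by rw [length_epsWalk]; omega) := by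
      simp only [h]
    rw [epsWalk_getElem_two, epsWalk_getElem_two] at h2
    have := congrArg pos1 h2
    rwa [pos1_vtx, pos1_vtx] at this

/-- **`E_{1,L}(x) → 0`** for `0 ≤ x < 1`: no mass escapes through the cuts of the width-one strip in the limit
(consistent with `HV.stripElim_one_eq_zero` at `x = x_c`). [cite: DuminilCopinSmirnov2012, §3 (E_{T,L})] -/
theorem tendsto_stripE_one {x : ℝ} (hx0 : 0 ≤ x) (hx1 : x < 1) :
    Tendsto (fun L : ℕ => stripE 1 L x) atTop (𝓝 0) := by
  have h := (tendsto_pow_atTop_nhds_zero_of_lt_one hx0 hx1).comp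
    ((tendsto_add_atTop_nat 2).comp (tendsto_id.const_mul_atTop' (by norm_num : 0 < 2)))
  rw [show (0 : ℝ) = 2 * 0 by ring]
  refine (h.const_mul 2).congr fun L => ?_
  simp only [Function.comp_apply, id]
  rw [stripE_one_eq]

/-- **Duminil-Copin–Smirnov's Lemma 2 at `T = 1`, in closed form**: for every `L`,
`1 = cos(3π/8) · 2 Σ_{j=1}^{L} x_c^{2j+1} + 2 Σ_{k=1}^{L+1} x_c^{2k} + cos(π/4) · 2 x_c^{2L+2}` — the tree's
`DuminilCopinSmirnov2012_lemma2_holds` read through the width-one classification.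
[cite: DuminilCopinSmirnov2012, Lemma 2 (T = 1)] -/
theorem lemma2_width_one_explicit (L : ℕ) :
    1 = Real.cos (3 * Real.pi / 8) * (2 * ∑ j ∈ Icc 1 L, hexCriticalFugacity ^ (2 * j + 1)) +
      2 * ∑ k ∈ Icc 1 (L + 1), hexCriticalFugacity ^ (2 * k) +
      Real.cos (Real.pi / 4) * (2 * hexCriticalFugacity ^ (2 * L + 2)) := by
  rw [← stripA_one_eq, ← stripB_one_eq, ← stripE_one_eq]
  exact DuminilCopinSmirnov2012_lemma2_holds 1 L le_rfl

/-! ### `A₁(x_c) = x_c (2√2 − 2)` -/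

/-- **`A₁(x_c) = x_c (2√2 − 2)`** (`= 2x_c³/(1 − x_c²)`, `x_c² = 1/(2+√2)`): the exact value of the width-one
`α`-constant `A_1(x_c) = sup_L A_{1,L}(x_c) = stripAlim 1`, companion of `HV.stripBlim_one_eq : B₁(x_c) = 2√2 − 2`.
[cite: DuminilCopinSmirnov2012, §3 (A_T)] -/
theorem stripAlim_one_eq : stripAlim 1 = hexCriticalFugacity * (2 * Real.sqrt 2 - 2) := by
  obtain ⟨hxc0, hxc1⟩ := hexCriticalFugacity_pos_lt_one
  have h1 := tendsto_stripA DuminilCopinSmirnov2012_lemma2_holds (le_refl 1)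
  have h2 := BGJ12.tendsto_stripA_one_A0 hxc0.le hxc1
  rw [← BGJ12.A0_xc]
  exact tendsto_nhds_unique h1 h2

namespace BGJ12

/-- The printed `A_0` at `z_c` is the tree's width-one strip constant `A₁(x_c)` (`HV.stripAlim_one_eq`).
[cite: BeatonGuttmannJensen2012, §2 p. 4; DuminilCopinSmirnov2012, §3 (A_T)] -/
theorem A0_xc_eq_stripAlim_one : A0 hexCriticalFugacity = stripAlim 1 := by
  rw [A0_xc, stripAlim_one_eq]

/-- Duminil-Copin–Smirnov's strip identity at `T = 1` in closed form: `cos(3π/8)·A₁(x_c) + B₁(x_c) = 1` with the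
tree's strip constants — the `T = 1` instance of the tree's unconditional infinite-strip identity
(`HexSAWStripIdentity.lean`, Glazman–Manolescu Cor. 2.3), checked here directly from the closed forms `A₁(x_c)`,
`B₁(x_c)` and Beaton–Guttmann–Jensen's printed identity (8) at `T = 0`.
[cite: DuminilCopinSmirnov2012, Lemma 2 (T = 1); BeatonGuttmannJensen2012, §2 (8); GlazmanManolescu2019, Corollary 2.3] -/
theorem identity_stripLim_one : Real.cos (3 * Real.pi / 8) * stripAlim 1 + stripBlim 1 = 1 := by
  rw [← A0_xc_eq_stripAlim_one, ← B0_xc_eq_stripBlim_one]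
  exact identity_zero

end BGJ12

/-- **`E₁(x_c) = 0`** from the closed forms: the width-one escape constant
`stripElim 1 = (1 − cos(3π/8)·A₁ − B₁)/cos(π/4)` vanishes. This is the `T = 1` instance of the tree's general
unconditional `HV.stripElim_zero : ∀ T ≥ 1, stripElim T = 0` (`HexSAWStripIdentity.lean`, via Glazman–Manolescu's
triangle-domain bound; [cite: GlazmanManolescu2019, Corollary 2.3]); the point of this version is only that at `T = 1`
it is an identity between explicit algebraic numbers (`HV.stripAlim_one_eq`, `HV.stripBlim_one_eq`), with no
limiting argument beyond the two geometric series. (`HV.stripElim_eq_zero` of `HexSAWLowerBound.lean` is the older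
conditional form.) [cite: DuminilCopinSmirnov2012, §3 (4), proof of Theorem 1] -/
theorem stripElim_one_eq_zero : stripElim 1 = 0 := by
  have h := BGJ12.identity_stripLim_one
  rw [stripElim, show 1 - Real.cos (3 * Real.pi / 8) * stripAlim 1 - stripBlim 1 = 0 by linarith, zero_div]

end HV

end Literature.Probability.RandomPlanarGeometry.SAW

end
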